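import Summits.MatrixMultiplication.MatrixMultiplication.Theorems.FarEdgeDescentSignTwistComm
import Literature.Computability.AlgebraicComplexity.MatMulMonomialSubrank
import Literature.Computability.AlgebraicComplexity.KroneckerRank
import HarnessLib

/-!
# The generic class `𝔖^♭` still decides `ω`: the s-rank bridge

Route `FarEdgeDescent` (cell `decomp-mm`, lens 2 «structural dichotomy (special vs generic)»,
gen 32), Kernel VII; support for the aside `SubLogRate` (stmt-MatrixMultiplication-25371).

The sign star `𝔖^♭ = signStar K : (X; y, y') ↦ (Xy, X^♭y')` is the generic same-support twist of
`⟨2,2,2⟩`: it has EXACTLY the support of `⟨2,2,2⟩` (one sign flipped), it is a quantum twin of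
`⟨2,2,2⟩`, and the two are degeneration-incomparable (`FarEdgeDescentGenericAntichain`; for the
Kronecker powers `⟨2,2,2⟩^{⊠N} ⋭ (𝔖^♭)^{⊠N}` for every `N`, `FarEdgeDescentSignTwistCommPow`).
Nevertheless the generic class is NOT decoupled from the summit: by Cohn–Umans weight removal
(`ω ≤ (3ω_s − 2)/2`, CU13 Thm. 6) fast algorithms for the POWERS OF `𝔖^♭` bound `ω`.

* `signStar_ne_zero_iff`: `supp 𝔖^♭ = supp ⟨2,2,2⟩` under the leaf relabelling `leafMM`
  (every field);
* `support_signStarPow`: `(𝔖^♭)^{⊠N}`, relabelled (`signStarPow`), has EXACTLY the support of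
  `⟨2^N, 2^N, 2^N⟩` (every field, every `N`) — verbatim the predicate
  `SameSupport (matMulTensor K (2^N) (2^N) (2^N)) (signStarPow K N)` of the tree's module
  `SupportRank` (Cohn–Umans, Def. 1), spelled out so that this file does not depend on it;
* `tensorRank_signStarPow`: the relabelling has the rank of `(𝔖^♭)^{⊠N}`;
* `exists_support_matMulTensor_rank_eq`: hence for every `N` a tensor with the support of
  `⟨2^N,2^N,2^N⟩` and the rank of `(𝔖^♭)^{⊠N}`: `R_s(⟨2^N,2^N,2^N⟩) ≤ R((𝔖^♭)^{⊠N})`, and — feeding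
  the witness to `SupportRank.omega_le_of_sameSupport_rank_le` (CU13 Prop. 5 + Thm. 6 as named
  facts) — **if `R((𝔖^♭)^{⊠N}) ≤ (2^N)^{2+ε}` for some `N ≥ 1` then `ω ≤ 2 + 3ε/2`**: rank bounds
  `R((𝔖^♭)^{⊠N}) ≤ 4^{N(1+o(1))}` along the GENERIC class give `ω = 2`.

So in the special-vs-generic dichotomy at `n = 2, L = 1` the generic same-support class is an
`ω`-complete object modulo weight removal, although no degeneration relates it to `⟨2,2,2⟩` at any
level `N` in the direction `⟨2,2,2⟩^{⊠N} ⊵ (𝔖^♭)^{⊠N}`.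

References: H. Cohn, C. Umans, *Fast matrix multiplication using coherent configurations*,
SODA 2013, Def. 1, Def. 4, Prop. 5, Thm. 6 [CohnUmans2013] (arXiv:1207.6528, p. 8);
M. Bläser, *Fast Matrix Multiplication* (2013), Lemma 5.4 [Blaser2013];
P. Bürgisser, M. Clausen, M. A. Shokrollahi, *Algebraic Complexity Theory* (1997), (14.23)
[BurgisserClausenShokrollahi1997].
-/

noncomputable section

open scoped BigOperators

set_option linter.dupNamespace false

namespace Summit.MatrixMultiplication.MatrixMultiplication.Theorems.FarEdgeDescentSignStarSRank

open Literature.Computability.AlgebraicComplexity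
open Summit.MatrixMultiplication.MatrixMultiplication.Theorems.FarEdgeDescentSignTwist
open Summit.MatrixMultiplication.MatrixMultiplication.Theorems.FarEdgeDescentSignTwistComm

universe u

/-- The two leaves `(Fin 2 × Fin 1) ⊕ (Fin 2 × Fin 1)`. [folklore] -/
abbrev Leaf := (Fin 2 × Fin 1) ⊕ (Fin 2 × Fin 1)

/-! ## `supp 𝔖^♭ = supp ⟨2,2,2⟩` -/

/-- Leaf relabelling `inl (i,0) ↦ (i,0)`, `inr (i,0) ↦ (i,1)`: the leaf becomes the column index
of the `⟨2,2,2⟩` format `a = (i, l)`, `c = (j, l)`. [folklore] -/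
def leafMM : Leaf ≃ Fin 2 × Fin 2 where
  toFun := Sum.elim (fun z => (z.1, 0)) (fun z => (z.1, 1))
  invFun p := if p.2 = 0 then Sum.inl (p.1, 0) else Sum.inr (p.1, 0)
  left_inv := by decide
  right_inv := by decide

/-- `leafMM` on the first leaf. [folklore] -/
@[simp] theorem leafMM_inl (z : Fin 2 × Fin 1) : leafMM (Sum.inl z) = (z.1, 0) := rfl

/-- `leafMM` on the second leaf. [folklore] -/
@[simp] theorem leafMM_inr (z : Fin 2 × Fin 1) : leafMM (Sum.inr z) = (z.1, 1) := rfl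

section Support
variable (K : Type u) [Field K]

/-- **`𝔖^♭` has exactly the support of `⟨2,2,2⟩`** (under `leafMM`; every field: the weights are
`±1 ≠ 0`). [cite: CohnUmans2013, Def. 1] -/
theorem signStar_ne_zero_iff (a : Leaf) (x : Fin 2 × Fin 2) (c : Leaf) :
    signStar K a x c ≠ 0 ↔ matMulTensor K 2 2 2 (leafMM a) x (leafMM c) ≠ 0 := by
  obtain ⟨x₁, x₂⟩ := x
  rcases a with ⟨i, l⟩ | ⟨i, l⟩ <;> rcases c with ⟨k, l'⟩ | ⟨k, l'⟩
  · rw [signStar_inl_inl, leafMM_inl, leafMM_inl]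
    fin_cases i <;> fin_cases k <;> fin_cases x₁ <;> fin_cases x₂ <;> simp [matMulTensor]
  · simp [matMulTensor]
  · simp [matMulTensor]
  · rw [signStar_inr_inr, leafMM_inr, leafMM_inr]
    fin_cases i <;> fin_cases k <;> fin_cases x₁ <;> fin_cases x₂ <;>
      simp [matMulTensor, sgnWeight]

/-- The same with the relabelling on the `⟨2,2,2⟩` side. [cite: CohnUmans2013, Def. 1] -/
theorem signStar_symm_ne_zero_iff (a : Fin 2 × Fin 2) (x : Fin 2 × Fin 2) (c : Fin 2 × Fin 2) :
    signStar K (leafMM.symm a) x (leafMM.symm c) ≠ 0 ↔ matMulTensor K 2 2 2 a x c ≠ 0 := by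
  simpa using signStar_ne_zero_iff K (leafMM.symm a) x (leafMM.symm c)

/-! ## `(𝔖^♭)^{⊠N}` relabelled to the format of `⟨2^N, 2^N, 2^N⟩` -/

/-- Un-flattening of the middle index `Fin 2^N × Fin 2^N ≃ (Fin N → Fin 2 × Fin 2)`.
[folklore] -/
def midIdx (N : ℕ) : (Fin (2 ^ N) × Fin (2 ^ N)) ≃ (Fin N → Fin 2 × Fin 2) where
  toFun b := fun i => ((finFunctionFinEquiv.symm b.1) i, (finFunctionFinEquiv.symm b.2) i)
  invFun f := (finFunctionFinEquiv (fun i => (f i).1), finFunctionFinEquiv (fun i => (f i).2))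
  left_inv b := by obtain ⟨b₁, b₂⟩ := b; simp
  right_inv f := by simp

/-- Un-flattening of the outer indices `Fin 2^N × Fin 2^N ≃ (Fin N → Leaf)` through `leafMM`.
[folklore] -/
def leafIdxPow (N : ℕ) : (Fin (2 ^ N) × Fin (2 ^ N)) ≃ (Fin N → Leaf) where
  toFun a := fun i =>
    leafMM.symm ((finFunctionFinEquiv.symm a.1) i, (finFunctionFinEquiv.symm a.2) i)
  invFun g := (finFunctionFinEquiv (fun i => (leafMM (g i)).1),
    finFunctionFinEquiv (fun i => (leafMM (g i)).2))
  left_inv a := by obtain ⟨a₁, a₂⟩ := a; simp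
  right_inv g := by simp

/-- `midIdx` in coordinates. [folklore] -/
theorem midIdx_apply (N : ℕ) (b : Fin (2 ^ N) × Fin (2 ^ N)) :
    midIdx N b = fun i => ((finFunctionFinEquiv.symm b.1) i, (finFunctionFinEquiv.symm b.2) i) :=
  rfl

/-- `leafIdxPow` in coordinates. [folklore] -/
theorem leafIdxPow_apply (N : ℕ) (a : Fin (2 ^ N) × Fin (2 ^ N)) :
    leafIdxPow N a = fun i =>
      leafMM.symm ((finFunctionFinEquiv.symm a.1) i, (finFunctionFinEquiv.symm a.2) i) :=
  rfl

/-- **`(𝔖^♭)^{⊠N}` in the format of `⟨2^N,2^N,2^N⟩`.** [folklore] -/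
def signStarPow (N : ℕ) :
    (Fin (2 ^ N) × Fin (2 ^ N)) → (Fin (2 ^ N) × Fin (2 ^ N)) → (Fin (2 ^ N) × Fin (2 ^ N)) → K :=
  fun a b c => kroneckerPow (signStar K) N (leafIdxPow N a) (midIdx N b) (leafIdxPow N c)

/-- The relabelling does not change the rank. [cite: Blaser2013, Lemma 5.4] -/
theorem tensorRank_signStarPow (N : ℕ) :
    tensorRank (signStarPow K N) = tensorRank (kroneckerPow (signStar K) N) :=
  tensorRank_reindex (leafIdxPow N) (midIdx N) (leafIdxPow N) (kroneckerPow (signStar K) N)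

/-- **`(𝔖^♭)^{⊠N}` has EXACTLY the support of `⟨2^N, 2^N, 2^N⟩`** (every field, every `N`;
this is `SameSupport (matMulTensor K (2^N) (2^N) (2^N)) (signStarPow K N)` of Cohn–Umans, Def. 1,
spelled out). [cite: CohnUmans2013, Def. 1] -/
theorem support_signStarPow (N : ℕ) :
    ∀ a b c, matMulTensor K (2 ^ N) (2 ^ N) (2 ^ N) a b c ≠ 0 ↔ signStarPow K N a b c ≠ 0 := by
  intro a b c
  rw [matMulTensor_pow_eq_kroneckerPow_comp K 2 2 2 N]
  simp only [signStarPow, leafIdxPow_apply, midIdx_apply, kroneckerPow_apply, ne_eq,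
    Finset.prod_eq_zero_iff, Finset.mem_univ, true_and, not_exists]
  exact forall_congr' fun i => by
    simpa only [ne_eq] using (signStar_symm_ne_zero_iff K _ _ _).symm

/-- **A tensor with the support of `⟨2^N,2^N,2^N⟩` and the rank of `(𝔖^♭)^{⊠N}`**, for every `N`
and every field: the witness that bounds the support rank `R_s(⟨2^N,2^N,2^N⟩)` (Cohn–Umans,
Def. 1) by `R((𝔖^♭)^{⊠N})`, and through weight removal (Cohn–Umans, Prop. 5 and Thm. 6:
`ω ≤ (3ω_s - 2)/2`) turns rank bounds for the powers of the generic class `𝔖^♭` into bounds on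
`ω`. [cite: CohnUmans2013, Def. 1, Prop. 5, Thm. 6] -/
theorem exists_support_matMulTensor_rank_eq (N : ℕ) :
    ∃ t : (Fin (2 ^ N) × Fin (2 ^ N)) → (Fin (2 ^ N) × Fin (2 ^ N)) →
        (Fin (2 ^ N) × Fin (2 ^ N)) → K,
      (∀ a b c, matMulTensor K (2 ^ N) (2 ^ N) (2 ^ N) a b c ≠ 0 ↔ t a b c ≠ 0) ∧
        tensorRank t = tensorRank (kroneckerPow (signStar K) N) :=
  ⟨signStarPow K N, support_signStarPow K N, tensorRank_signStarPow K N⟩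

end Support

end Summit.MatrixMultiplication.MatrixMultiplication.Theorems.FarEdgeDescentSignStarSRank

end
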